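import Summits.BirchSwinnertonDyer.BirchSwinnertonDyer.Theorems.ByReductionTypeAtTwoSlopePinchAlgebra
import HarnessLib

/-!
# The SLOPE PINCH in `Λ = ℤ_p⟦T⟧` (pure algebra), part B: the cofactor's constant term CANNOT have valuation `2`
# under the coefficient shape `v(L₀) = s ≥ 6`, `p⁴ ∣ L₁`, `v(L₂) = 1` — and the unit criterion it feeds

HONEST FRAMING (cell `bsd-2adic`, run/shared/lean/pub/bsd-2adic/, seat `bsd-2adic-mult-3` GEN 10, HUMAN RULINGS
D-0036 / D-0054 / D-0074 row (A)): research route; THEOREMS ONLY (pure commutative algebra over `ℤ_p`, Mathlib + this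
seat's GEN 9 `SlopePinch` bookkeeping lemmas) — no definition, no named fact, nothing asserted, nothing booked; BSD is not
proved by any of this. Route-free; the algebra core of the designed TORSION-TOLERANT slope-pinch road (HOME/HANDOFF.md
§ bsd-2adic-mult-3 GEN 10, (R1); planner file RC-118): there the arithmetic supplies `v(b₀) = ord₂#Ш_an − ord₂#Ш ∈ {0, 2}`
(Cassels–Tate parity + a level-4 descent certificate), NOT `λ(f) ≥ 3` (which needs odd torsion), and this file removes `2`.

## What is proved

Let `f, b ∈ Λ = ℤ_p⟦T⟧` with product `L = f·b`, coefficients `Lᵢ`, `fᵢ`, `bᵢ`, `v` the `p`-adic valuation on `ℤ_p`.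
* `valuation_coeff_zero_ne_two_of_slopeShape`: if `v(L₀) = s` with `6 ≤ s`, `p⁴ ∣ L₁`, `L₂ ≠ 0` with `v(L₂) = 1`,
  then `v(b₀) ≠ 2`. Proof (coefficient bookkeeping): were `v(b₀) = 2`, then `v(f₀) = s − 2 ≥ 4`, so `p² ∣ f₀b₂` and
  `p² ∣ f₂b₀`, whence `v(f₁b₁) = 1`, i.e. `{v(f₁), v(b₁)} = {0, 1}`; if `v(f₁) = 1` then `L₁ = f₀b₁ + f₁b₀` has valuation
  `min(s − 2, 3) = 3`, if `v(f₁) = 0` it has valuation `min(s − 1, 2) = 2` — either way `p⁴ ∤ L₁`.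
* `isUnit_of_slopeShape_of_valuation_le_two_of_ne_one`: if moreover `v(b₀) ≤ 2` and `v(b₀) ≠ 1`, then `b ∈ Λˣ`.
In Newton-polygon language (orientation only, not used): the polygon of `L` starts `(0,s) → (2,1)` (one segment of slope
`(s−1)/2 ≥ 5/2`, or `(0,s) → (1,4) → (2,1)` when `v(L₁) = 4 ≤ (s+1)/2`), then slope `1` or less; no sub-product of roots
has valuation exactly `2`.

References: L. Washington, *Introduction to Cyclotomic Fields*, §7.1 (Weierstrass preparation, units of `Λ`);
N. Koblitz, *p-adic Numbers, p-adic Analysis, and Zeta-Functions*, IV.3 (Newton polygons; orientation only).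
-/

set_option autoImplicit false
set_option linter.dupNamespace false

noncomputable section

open scoped Classical

open Literature.NumberTheory.EllipticCurves Summit.BirchSwinnertonDyer.Rank1Residual.X1.MuLambda

namespace Summit.BirchSwinnertonDyer.BirchSwinnertonDyer.Theorems.SlopePinch

variable {p : ℕ} [Fact p.Prime]

/-- **Slope shape B: `v(b₀) ≠ 2`.** `f, b ∈ Λ`, `L = f·b` with `v(L₀) = s`, `6 ≤ s`, `p⁴ ∣ L₁`, `L₂ ≠ 0`, `v(L₂) = 1`
⇒ the constant term of `b` does not have valuation `2`. [cite: Washington1997, §7.1 (Weierstrass preparation: units of Λ, μ and λ)] -/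
theorem valuation_coeff_zero_ne_two_of_slopeShape {f b : IwasawaAlgebra p} {s : ℕ}
    (hL0 : PowerSeries.coeff 0 (f * b) ≠ 0) (hs : (PowerSeries.coeff 0 (f * b)).valuation = s) (hs6 : 6 ≤ s)
    (hL1 : (p : ℤ_[p]) ^ 4 ∣ PowerSeries.coeff 1 (f * b))
    (hL2 : PowerSeries.coeff 2 (f * b) ≠ 0 ∧ (PowerSeries.coeff 2 (f * b)).valuation = 1) :
    (PowerSeries.coeff 0 b).valuation ≠ 2 := by
  intro hb2
  set f0 := PowerSeries.coeff 0 f with hf0def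
  set f1 := PowerSeries.coeff 1 f with hf1def
  set f2 := PowerSeries.coeff 2 f with hf2def
  set b0 := PowerSeries.coeff 0 b with hb0def
  set b1 := PowerSeries.coeff 1 b with hb1def
  set b2 := PowerSeries.coeff 2 b with hb2def
  have hL0eq : PowerSeries.coeff 0 (f * b) = f0 * b0 := coeff_zero_mul' f b
  have hL1eq : PowerSeries.coeff 1 (f * b) = f0 * b1 + f1 * b0 := coeff_one_mul' f b
  have hL2eq : PowerSeries.coeff 2 (f * b) = f0 * b2 + f1 * b1 + f2 * b0 := coeff_two_mul' f b
  have hf00 : f0 ≠ 0 := fun h0 => hL0 (by rw [hL0eq, h0, zero_mul])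
  have hb00 : b0 ≠ 0 := fun h0 => hL0 (by rw [hL0eq, h0, mul_zero])
  -- `v(f₀) = s - 2 ≥ 4`
  have hsum : f0.valuation + b0.valuation = s := by
    rw [← PadicInt.valuation_mul hf00 hb00, ← hL0eq]; exact hs
  have hvf0 : f0.valuation = s - 2 := by omega
  have hp2f0 : (p : ℤ_[p]) ^ 2 ∣ f0 := (padicInt_pow_dvd_iff_le_valuation hf00 2).mpr (by omega)
  have hp2b0 : (p : ℤ_[p]) ^ 2 ∣ b0 := (padicInt_pow_dvd_iff_le_valuation hb00 2).mpr (by omega)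
  have hpb0 : (p : ℤ_[p]) ∣ b0 := dvd_trans (dvd_pow_self _ two_ne_zero) hp2b0
  have hpf0 : (p : ℤ_[p]) ∣ f0 := dvd_trans (dvd_pow_self _ two_ne_zero) hp2f0
  -- `p² ∤ L₂`, `p ∣ L₂`
  have hnot2 : ¬ (p : ℤ_[p]) ^ 2 ∣ PowerSeries.coeff 2 (f * b) := by
    intro hd
    have := (padicInt_pow_dvd_iff_le_valuation hL2.1 2).mp hd
    rw [hL2.2] at this
    omega
  have hdvd2 : (p : ℤ_[p]) ∣ PowerSeries.coeff 2 (f * b) := by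
    have := (padicInt_pow_dvd_iff_le_valuation hL2.1 1).mpr (by rw [hL2.2])
    rwa [pow_one] at this
  have hp2_f0b2 : (p : ℤ_[p]) ^ 2 ∣ f0 * b2 := dvd_mul_of_dvd_left hp2f0 _
  have hp2_f2b0 : (p : ℤ_[p]) ^ 2 ∣ f2 * b0 := dvd_mul_of_dvd_right hp2b0 _
  -- hence `v(f₁ b₁) = 1`: `p ∣ f₁b₁` and `p² ∤ f₁b₁`
  have hp_f1b1 : (p : ℤ_[p]) ∣ f1 * b1 := by
    have h := dvd_sub hdvd2 (dvd_add (dvd_trans (dvd_pow_self _ two_ne_zero) hp2_f0b2)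
      (dvd_trans (dvd_pow_self _ two_ne_zero) hp2_f2b0))
    rw [hL2eq] at h
    have : f0 * b2 + f1 * b1 + f2 * b0 - (f0 * b2 + f2 * b0) = f1 * b1 := by ring
    rwa [this] at h
  have hnp2_f1b1 : ¬ (p : ℤ_[p]) ^ 2 ∣ f1 * b1 := by
    intro hd
    exact hnot2 (by rw [hL2eq]; exact dvd_add (dvd_add hp2_f0b2 hd) hp2_f2b0)
  have hf10 : f1 ≠ 0 := by
    intro h0; exact hnp2_f1b1 (by rw [h0, zero_mul]; exact dvd_zero _)
  have hb10 : b1 ≠ 0 := by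
    intro h0; exact hnp2_f1b1 (by rw [h0, mul_zero]; exact dvd_zero _)
  have hf1b1ne : f1 * b1 ≠ 0 := mul_ne_zero hf10 hb10
  have hv11 : f1.valuation + b1.valuation = 1 := by
    rw [← PadicInt.valuation_mul hf10 hb10]
    refine le_antisymm ?_ ((dvd_iff_one_le_valuation hf1b1ne).mp hp_f1b1)
    by_contra hgt
    push Not at hgt
    exact hnp2_f1b1 ((padicInt_pow_dvd_iff_le_valuation hf1b1ne 2).mpr hgt)
  -- `L₁ = f₀b₁ + f₁b₀ ≠ 0` has valuation `≥ 4`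
  have hne1 : f0 * b1 ≠ 0 := mul_ne_zero hf00 hb10
  have hne2 : f1 * b0 ≠ 0 := mul_ne_zero hf10 hb00
  have hv1 : (f0 * b1).valuation = (s - 2) + b1.valuation := by
    rw [PadicInt.valuation_mul hf00 hb10, hvf0]
  have hv2 : (f1 * b0).valuation = f1.valuation + 2 := by
    rw [PadicInt.valuation_mul hf10 hb00, hb2]
  -- the two cases `(v f₁, v b₁) = (1, 0)` or `(0, 1)`
  rcases Nat.eq_zero_or_pos f1.valuation with hf1z | hf1pos
  · -- `v(f₁) = 0`, `v(b₁) = 1`: `v(f₁b₀) = 2 < s - 1 = v(f₀b₁)` ⇒ `v(L₁) = 2 < 4`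
    have hb1v : b1.valuation = 1 := by omega
    have hlt : (f1 * b0).valuation < (f0 * b1).valuation := by rw [hv1, hv2, hf1z, hb1v]; omega
    obtain ⟨hne, hval⟩ := valuation_add_eq_left hne2 hlt
    rw [add_comm] at hne hval
    have h4 : 4 ≤ (f0 * b1 + f1 * b0).valuation := by
      rw [← hL1eq]; exact (padicInt_pow_dvd_iff_le_valuation (by rw [hL1eq]; exact hne) 4).mp hL1
    rw [hval, hv2, hf1z] at h4
    omega
  · -- `v(f₁) = 1`, `v(b₁) = 0`: `v(f₁b₀) = 3 < s - 2 = v(f₀b₁)` ⇒ `v(L₁) = 3 < 4`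
    have hf1v : f1.valuation = 1 := by omega
    have hb1v : b1.valuation = 0 := by omega
    have hlt : (f1 * b0).valuation < (f0 * b1).valuation := by rw [hv1, hv2, hf1v, hb1v]; omega
    obtain ⟨hne, hval⟩ := valuation_add_eq_left hne2 hlt
    rw [add_comm] at hne hval
    have h4 : 4 ≤ (f0 * b1 + f1 * b0).valuation := by
      rw [← hL1eq]; exact (padicInt_pow_dvd_iff_le_valuation (by rw [hL1eq]; exact hne) 4).mp hL1
    rw [hval, hv2, hf1v] at h4
    omega

/-- **The unit criterion of the torsion-tolerant slope pinch (pure algebra).** Under the slope shape B (`v(L₀) = s ≥ 6`,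
`p⁴ ∣ L₁`, `v(L₂) = 1`), a cofactor `b` whose constant term has valuation `≤ 2` and `≠ 1` is a unit of `Λ` (the arithmetic
side supplies `v(b₀) = ord_p #Ш_an − ord_p #Ш ∈ {0, 2}` from a level-`(m−2)` descent certificate and Cassels–Tate parity).
[cite: Washington1997, §7.1 (units of Λ = power series with unit constant term)] -/
theorem isUnit_of_slopeShape_of_valuation_le_two_of_ne_one {f b : IwasawaAlgebra p} {s : ℕ}
    (hL0 : PowerSeries.coeff 0 (f * b) ≠ 0) (hs : (PowerSeries.coeff 0 (f * b)).valuation = s) (hs6 : 6 ≤ s)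
    (hL1 : (p : ℤ_[p]) ^ 4 ∣ PowerSeries.coeff 1 (f * b))
    (hL2 : PowerSeries.coeff 2 (f * b) ≠ 0 ∧ (PowerSeries.coeff 2 (f * b)).valuation = 1)
    (hle : (PowerSeries.coeff 0 b).valuation ≤ 2) (hne1 : (PowerSeries.coeff 0 b).valuation ≠ 1) : IsUnit b := by
  have hne2 := valuation_coeff_zero_ne_two_of_slopeShape hL0 hs hs6 hL1 hL2
  have hv0 : (PowerSeries.coeff 0 b).valuation = 0 := by omega
  have hb00 : PowerSeries.coeff 0 b ≠ 0 := fun h0 => hL0 (by rw [coeff_zero_mul', h0, mul_zero])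
  apply PowerSeries.isUnit_iff_constantCoeff.mpr
  rw [← PowerSeries.coeff_zero_eq_constantCoeff_apply]
  by_contra hnu
  have hpd : (p : ℤ_[p]) ∣ PowerSeries.coeff 0 b := (p_dvd_iff_not_isUnit _).mpr hnu
  have := (dvd_iff_one_le_valuation hb00).mp hpd
  omega

/-- **Ideal form**: under the same hypotheses `(f·b) = (f)` in `Λ` (for `f ≠ 0`).
[cite: GreenbergVatsal2000, p. 4 (after Thm. (1.2): a divisibility with matching size is an equality)] -/
theorem span_mul_eq_span_of_slopeShape {f b : IwasawaAlgebra p} {s : ℕ} (hf : f ≠ 0)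
    (hL0 : PowerSeries.coeff 0 (f * b) ≠ 0) (hs : (PowerSeries.coeff 0 (f * b)).valuation = s) (hs6 : 6 ≤ s)
    (hL1 : (p : ℤ_[p]) ^ 4 ∣ PowerSeries.coeff 1 (f * b))
    (hL2 : PowerSeries.coeff 2 (f * b) ≠ 0 ∧ (PowerSeries.coeff 2 (f * b)).valuation = 1)
    (hle : (PowerSeries.coeff 0 b).valuation ≤ 2) (hne1 : (PowerSeries.coeff 0 b).valuation ≠ 1) :
    Ideal.span ({f * b} : Set (IwasawaAlgebra p)) = Ideal.span {f} :=
  (span_eq_span_iff_isUnit hf rfl).mpr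
    (isUnit_of_slopeShape_of_valuation_le_two_of_ne_one hL0 hs hs6 hL1 hL2 hle hne1)

end Summit.BirchSwinnertonDyer.BirchSwinnertonDyer.Theorems.SlopePinch

end
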